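import Mathlib
import Summits.Ventures.HodgeRepro.Tier4.Common.KTypeSpace
import Summits.Ventures.HodgeRepro.Tier4.Line1.MaximalFamily
import Summits.Ventures.HodgeRepro.Tier4.Line4.MaximalFamilyClosed

/-!
# Tier4/Common/PseudoCoeff — the PSEUDO-COEFFICIENT property of a test function at the place `w₀`, as a DISPLAYED
predicate, and its consequence: the admissibility clauses «lowest `K`-type at `w₀`» for every constituent the
operator `R(f̄₁)` does not kill

Blind re-derivation cell `pub-hodge-repro`, Tier 4 «prove the step» (README §9–§10), seat t4-typer-2 (gen 3), the
cut C-L4-PSEUDO of t4-plan-4 g2 (S14010).  Target tree path `lean/Summits/Ventures/HodgeRepro/Tier4/Common/PseudoCoeff.lean`.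
Mathlib + `Common.KTypeSpace` (`HasKTypeAt`, `HasKTypeAt'`, `IsAdmissibleS`), `Line1.MaximalFamily`
(`RTF.Setting.IsIrrNonzero`), `Line4.MaximalFamilyClosed` (`IsClosedSub`); no literature PROVED here.

WHAT THIS IS (plan-4 S14010 (2), FINDING F-L4-HADM): the admissibility clauses (5)/(7) of `IsAdmissibleS` — «no
`K`-type of difference `±1` at `w₀`», i.e. the hit constituent is LOWEST at `w₀` — are wall content unless the test
function at `w₀` is a PSEUDO-COEFFICIENT of the weight-`3` discrete series: then every constituent carrying a `K`-type
in the forbidden window is killed by `R(f̄₁)`, so the constituents `R(f̄₁)` hits satisfy (5)/(7) automatically.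
`IsPseudoCoeffAt'` is that property as a predicate on `f₁` (the `T′`-side, `HasKTypeAt'`), `IsPseudoCoeffAt` the
`T`-side twin; `not_hasKTypeAt'_of_isPseudoCoeffAt'_of_hit` / `not_hasKTypeAt_of_isPseudoCoeffAt_of_hit` are the
consequences, by contraposition — clause (7) / (5) of `IsAdmissibleS` on `Submodule.span ℂ V` for every hit `V`.

PRINT CAVEAT (t4-lit-6 S14023, recorded here so no consumer mistakes the display for the Corollary): Clozel–Delorme,
«Le théorème de Paley–Wiener invariant pour les groupes de Lie réductifs II», Ann. Sci. ÉNS 23 (1990) 193–228, §5.2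
Corollaire p. 213 gives, for a discrete series `δ₀` of a connected reductive `G(ℝ)` with compact centre, a
`K`-bi-finite `f ∈ C_c^∞(G, K)` with `tr δ₀(f) = 1` and `tr π_{δ,ν}(f) = 0` for every basic `π_{δ,ν} ≠ δ₀` — a statement
about TRACES.  The predicate below is the OPERATOR reading «`R(f̄₁) = 0` on every closed irreducible invariant
subspace whose `w₀`-type lies in the window», which is STRONGER than the printed Corollary; its discharge is a
Paley–Wiener / Arthur-type statement on the operator-valued Fourier transform (lit-1's W-L4-5 family) or a weakening
of the predicate to the trace — a DISPLAYED hypothesis of the line, not a theorem here.  Nothing here asserts that a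
pseudo-coefficient in this sense exists.

* `IsPseudoCoeffAt'`, `IsPseudoCoeffAt` — the displayed predicates (`T′`- and `T`-side);
* **`not_hasKTypeAt'_of_isPseudoCoeffAt'_of_hit`**, **`not_hasKTypeAt_of_isPseudoCoeffAt_of_hit`** — clauses (7) / (5)
  of `IsAdmissibleS` for every constituent hit by `R(f̄₁)`;
* `isPseudoCoeffAt'_of_forall_eq_zero` — the degenerate instance (`R(f̄₁) = 0` on everything): the predicate is
  SATISFIABLE by a useless `f₁`, so a consumer must ALSO display that `R(f̄₁)` hits the constituent it needs
  (`hhit`) — the junk row, stated so it is visible.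

Nothing here says anything about the status of the Hodge conjecture for CM abelian varieties, which is NOT proved
(HC_CM is NOT proved by anyone in this repository).
-/

set_option autoImplicit false

noncomputable section

namespace Summit.Ventures.HodgeRepro.Tier4.Common

open NumberField MeasureTheory Summit.Ventures.HodgeRepro.Tier4.Line1

section Pseudo

variable {k : Type} [Field k] [NumberField k] (W : PlaneData k) [MeasurableSpace (GA W)]

/-- **The pseudo-coefficient property at `w₀` (`T′`-side)**: `R(f̄₁)` kills every closed non-zero irreducible invariant
subspace `V` carrying a `T′`-type at `w₀` in the window `|(eP′ − eM′) + 2 j| < 3` (the operator reading of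
Clozel–Delorme's Corollary — STRONGER than the print, see the module docstring; a DISPLAYED hypothesis). -/
def IsPseudoCoeffAt' (S : RTF.Setting (GA W)) (q : QuadData k) (g g' : Matrix (Fin 4) (Fin 4) k)
    (w₀ : InfinitePlace k) (eP' eM' : InfinitePlace k → ℤ) (f₁ : GA W → ℂ) : Prop :=
  ∀ V : Set (GA W → ℂ), Line4.IsClosedSub S V → S.IsIrrNonzero V →
    (∃ j : ℤ, |(eP' w₀ - eM' w₀) + 2 * j| < 3 ∧
      HasKTypeAt' W q w₀ g g' (eP' w₀ + j) (eM' w₀ - j) (Submodule.span ℂ V)) →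
    ∀ ψ ∈ V, rightRegular W S.μ (RTF.cj f₁) ψ = 0

/-- **The pseudo-coefficient property at `w₀` (`T`-side)**: the twin with `HasKTypeAt`. -/
def IsPseudoCoeffAt (S : RTF.Setting (GA W)) (q : QuadData k) (w₀ : InfinitePlace k) (eP eM : InfinitePlace k → ℤ)
    (f₁ : GA W → ℂ) : Prop :=
  ∀ V : Set (GA W → ℂ), Line4.IsClosedSub S V → S.IsIrrNonzero V →
    (∃ j : ℤ, |(eP w₀ - eM w₀) + 2 * j| < 3 ∧ HasKTypeAt W q w₀ (eP w₀ + j) (eM w₀ - j) (Submodule.span ℂ V)) →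
    ∀ ψ ∈ V, rightRegular W S.μ (RTF.cj f₁) ψ = 0

/-- **Clause (7) of `IsAdmissibleS` for every hit constituent**: if `f₁` is a pseudo-coefficient at `w₀` (`T′`-side) and
`R(f̄₁)` does not kill the closed non-zero irreducible `V`, then `Submodule.span ℂ V` has no `T′`-type at `w₀` in the
window. -/
theorem not_hasKTypeAt'_of_isPseudoCoeffAt'_of_hit (S : RTF.Setting (GA W)) (q : QuadData k)
    (g g' : Matrix (Fin 4) (Fin 4) k) (w₀ : InfinitePlace k) (eP' eM' : InfinitePlace k → ℤ) {f₁ : GA W → ℂ}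
    (hf : IsPseudoCoeffAt' W S q g g' w₀ eP' eM' f₁) {V : Set (GA W → ℂ)} (hc : Line4.IsClosedSub S V)
    (hi : S.IsIrrNonzero V) (hhit : ∃ ψ ∈ V, rightRegular W S.μ (RTF.cj f₁) ψ ≠ 0) :
    ∀ j : ℤ, |(eP' w₀ - eM' w₀) + 2 * j| < 3 →
      ¬ HasKTypeAt' W q w₀ g g' (eP' w₀ + j) (eM' w₀ - j) (Submodule.span ℂ V) := by
  intro j hj hK
  obtain ⟨ψ, hψ, hne⟩ := hhit
  exact hne (hf V hc hi ⟨j, hj, hK⟩ ψ hψ)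

/-- **Clause (5) of `IsAdmissibleS` for every hit constituent** (`T`-side twin). -/
theorem not_hasKTypeAt_of_isPseudoCoeffAt_of_hit (S : RTF.Setting (GA W)) (q : QuadData k) (w₀ : InfinitePlace k)
    (eP eM : InfinitePlace k → ℤ) {f₁ : GA W → ℂ} (hf : IsPseudoCoeffAt W S q w₀ eP eM f₁) {V : Set (GA W → ℂ)}
    (hc : Line4.IsClosedSub S V) (hi : S.IsIrrNonzero V)
    (hhit : ∃ ψ ∈ V, rightRegular W S.μ (RTF.cj f₁) ψ ≠ 0) :
    ∀ j : ℤ, |(eP w₀ - eM w₀) + 2 * j| < 3 → ¬ HasKTypeAt W q w₀ (eP w₀ + j) (eM w₀ - j) (Submodule.span ℂ V) := by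
  intro j hj hK
  obtain ⟨ψ, hψ, hne⟩ := hhit
  exact hne (hf V hc hi ⟨j, hj, hK⟩ ψ hψ)

/-- The junk row, visible: a test function with `R(f̄₁) = 0` everywhere is a pseudo-coefficient — so the predicate
alone carries no content; the consumer displays `hhit` as well. -/
theorem isPseudoCoeffAt'_of_forall_eq_zero (S : RTF.Setting (GA W)) (q : QuadData k) (g g' : Matrix (Fin 4) (Fin 4) k)
    (w₀ : InfinitePlace k) (eP' eM' : InfinitePlace k → ℤ) {f₁ : GA W → ℂ}
    (h0 : ∀ ψ : GA W → ℂ, rightRegular W S.μ (RTF.cj f₁) ψ = 0) :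
    IsPseudoCoeffAt' W S q g g' w₀ eP' eM' f₁ :=
  fun _ _ _ _ ψ _ => h0 ψ

end Pseudo

end Summit.Ventures.HodgeRepro.Tier4.Common

end
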